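import Mathlib
import Summits.QuantumFields.QCD.Theorems.QuarksAsStableActionUnquenchedChessboardBoundStubMarginalRPFeatures
import HarnessLib

/-!
# Marginal site-reflection positivity of the signed, determinant-weighted Wilson functional
(stub `stub_marginalRP` of crux stmt-QuantumFields-9735, line Sketch — main file)

For the site reflection `Θ'` (`GaugeConfig.negReflect`) of the even four-torus in the lattice
hyperplanes `t = 0`, `t = L/2`, every bounded measurable half-observable `F` of the closed half
`0 ≤ t ≤ L/2` and all bare masses `m_f > -1`:
`0 ≤ ∫ conj F(Θ'U) F(U) ∏_f det D_AP[U, m_f] e^{-β S_W(U)} ∏ dU_e` (`stub_marginalRP`).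

Proof: a *Gram datum* for a function `k` of the gauge field is a finite positive-semidefinite
kernel `K(U)` depending only on the shared (in-plane spatial) links and bounded measurable features
`a_i` depending only on the links of the closed half, with `k(U) = Σ_{ij} K(U)_{ij} a_i(U) conj a_j(Θ'U)`
(`GramData`). Gram data multiply (Kronecker products, `GramData.mul`); `conj F(Θ'U) F(U)`, the
gauge weight (split `S = const - A' - A'∘Θ' - S_M` of the tree) and — by the single-flavour Gram
identity and the kernel positivity of helper files 5–6 — every `det D_AP[U, m_f]` carry Gram data;
and a function with a Gram datum has non-negative integral (`GramData.integral_nonneg`: the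
polarised shared-block identity of helper file 7 reduces it to `∫ ⟨χ(V), K(V) χ(V)⟩ dV ≥ 0`).
-/

noncomputable section

open Matrix Complex Finset MeasureTheory
open Literature.MathematicalPhysics.QuantumLattice Literature.MathematicalPhysics.QuantumFieldTheory
open Literature.Probability.LatticeModels
open scoped ComplexConjugate BigOperators Kronecker ComplexOrder

namespace Summit.QuantumFields.QCD.Theorems.UnquenchedChessboardBoundLine

/-! ## Gram data -/

section Gram

variable {L : ℕ} [NeZero L] [Fact (1 < L)] {G : Type*} [Group G] [MeasurableSpace G]

/-- A **Gram datum** for a function of the gauge field with respect to the site reflection: a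
finite positive-semidefinite kernel depending on the shared links and bounded measurable features
depending on the links of the closed positive-time half, representing the function as
`k(U) = Σ_{ij} K(U)_{ij} a_i(U) conj a_j(Θ'U)`. -/
structure GramData (k : GaugeConfig 4 L G → ℂ) where
  /-- the index type -/
  κ : Type
  /-- it is finite -/
  [hκ : Fintype κ]
  /-- the kernel -/
  K : GaugeConfig 4 L G → Matrix κ κ ℂ
  /-- the features -/
  a : κ → GaugeConfig 4 L G → ℂ
  /-- positivity -/
  psd : ∀ U, (K U).PosSemidef
  /-- measurability of the kernel -/
  measK : ∀ i j, Measurable fun U => K U i j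
  /-- boundedness of the kernel -/
  bddK : ∃ C : ℝ, ∀ U i j, ‖K U i j‖ ≤ C
  /-- locality of the kernel -/
  depK : ∀ i j, DependsOn (fun U => K U i j) ((WilsonSiteRP.sharedEdges : Finset (Edge 4 L)) : Set (Edge 4 L))
  /-- measurability of the features -/
  measA : ∀ i, Measurable (a i)
  /-- boundedness of the features -/
  bddA : ∃ C : ℝ, ∀ i U, ‖a i U‖ ≤ C
  /-- locality of the features -/
  depA : ∀ i, DependsOn (a i)
    ((WilsonSiteRP.sitePosEdges ∪ WilsonSiteRP.sharedEdges : Finset (Edge 4 L)) : Set (Edge 4 L))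
  /-- the representation -/
  eq : ∀ U, k U = ∑ i, ∑ j, K U i j * a i U * conj (a j (GaugeConfig.negReflect U))

attribute [instance] GramData.hκ

omit [NeZero L] [Fact (1 < L)] [MeasurableSpace G] in
/-- Transport along a pointwise equality. -/
def GramData.congr {k k' : GaugeConfig 4 L G → ℂ} (d : GramData k) (h : ∀ U, k U = k' U) : GramData k' where
  κ := d.κ
  K := d.K
  a := d.a
  psd := d.psd
  measK := d.measK
  bddK := d.bddK
  depK := d.depK
  measA := d.measA
  bddA := d.bddA
  depA := d.depA
  eq U := (h U) ▸ d.eq U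

omit [NeZero L] [Fact (1 < L)] in
/-- **Products of Gram data** (Kronecker product of the kernels, products of the features). -/
def GramData.mul {k₁ k₂ : GaugeConfig 4 L G → ℂ} (d₁ : GramData k₁) (d₂ : GramData k₂) :
    GramData (fun U => k₁ U * k₂ U) where
  κ := d₁.κ × d₂.κ
  K U := d₁.K U ⊗ₖ d₂.K U
  a i U := d₁.a i.1 U * d₂.a i.2 U
  psd U := (d₁.psd U).kronecker (d₂.psd U)
  measK i j := (d₁.measK i.1 j.1).mul (d₂.measK i.2 j.2)
  bddK := by
    obtain ⟨C₁, h₁⟩ := d₁.bddK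
    obtain ⟨C₂, h₂⟩ := d₂.bddK
    refine ⟨C₁ * C₂, fun U i j => ?_⟩
    rw [Matrix.kroneckerMap_apply, norm_mul]
    exact mul_le_mul (h₁ U i.1 j.1) (h₂ U i.2 j.2) (norm_nonneg _) ((norm_nonneg _).trans (h₁ U i.1 j.1))
  depK i j U V hUV := by
    have h1 := d₁.depK i.1 j.1 hUV
    have h2 := d₂.depK i.2 j.2 hUV
    simp only at h1 h2
    simp only [Matrix.kroneckerMap_apply, h1, h2]
  measA i := (d₁.measA i.1).mul (d₂.measA i.2)
  bddA := by
    obtain ⟨C₁, h₁⟩ := d₁.bddA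
    obtain ⟨C₂, h₂⟩ := d₂.bddA
    refine ⟨C₁ * C₂, fun i U => ?_⟩
    rw [norm_mul]
    exact mul_le_mul (h₁ i.1 U) (h₂ i.2 U) (norm_nonneg _) ((norm_nonneg _).trans (h₁ i.1 U))
  depA i U V hUV := by simp only [d₁.depA i.1 hUV, d₂.depA i.2 hUV]
  eq U := by
    rw [d₁.eq U, d₂.eq U, Finset.sum_mul_sum]
    simp_rw [Finset.sum_mul_sum, Fintype.sum_prod_type]
    refine Finset.sum_congr rfl fun i _ => Finset.sum_congr rfl fun x _ => Finset.sum_congr rfl fun y _ =>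
      Finset.sum_congr rfl fun j _ => ?_
    simp only [Matrix.kroneckerMap_apply, map_mul]
    ring

omit [NeZero L] [Fact (1 < L)] in
/-- The Gram datum of `conj F(Θ'U) · F(U)` for a half-observable `F`. -/
def gramDataHalfObs {F : GaugeConfig 4 L G → ℂ} (hF : WilsonSiteRP.IsHalfObs F) :
    GramData (fun U => conj (F (GaugeConfig.negReflect U)) * F U) where
  κ := Unit
  K _ := 1
  a _ := F
  psd _ := Matrix.PosSemidef.one
  measK _ _ := measurable_const
  bddK := ⟨1, fun U i j => by simp⟩
  depK _ _ _ _ _ := rfl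
  measA _ := hF.measurable
  bddA := by obtain ⟨C, hC⟩ := hF.bounded; exact ⟨C, fun _ U => hC U⟩
  depA _ := hF.dependsOn
  eq U := by simp [mul_comm]

omit [NeZero L] [Fact (1 < L)] in
/-- Finite products of Gram data. -/
def gramDataProd {n : ℕ} (k : Fin n → GaugeConfig 4 L G → ℂ) (d : ∀ f, GramData (k f))
    (d1 : GramData (fun _ : GaugeConfig 4 L G => (1 : ℂ))) : GramData (fun U => ∏ f, k f U) := by
  induction n with
  | zero => exact d1.congr fun U => by simp
  | succ n ih =>
    exact ((d 0).mul (ih (fun f => k f.succ) (fun f => d f.succ))).congr fun U => by rw [Fin.prod_univ_succ]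

end Gram

/-! ## Gram data for the gauge weight and the fermion determinant -/

section Specific

variable {L N : ℕ} [NeZero L] [Fact (1 < L)] {G : Type*} [Group G] [TopologicalSpace G]
  [IsTopologicalGroup G] [CompactSpace G] [MeasurableSpace G] [BorelSpace G]

omit [Fact (1 < L)] in
/-- **Gram datum of the Wilson weight** `e^{-β S(U)}`: by the split `S = Nc - A'(U) - A'(Θ'U) - S_M(U)`
of the tree, kernel `e^{-βNc} e^{β S_M}` (shared links) and feature `e^{β A'}` (closed half). -/
def gramDataGauge (hL : Even L) (ρ : G →* Matrix (Fin N) (Fin N) ℂ) (hρ : Continuous ρ) (β : ℝ) :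
    GramData (fun U : GaugeConfig 4 L G => (Real.exp (-β * wilsonAction ρ U) : ℂ)) where
  κ := Unit
  K U := ((Real.exp (-β * (N * Fintype.card (Plaquette 4 L))) * Real.exp (β * WilsonSiteRP.sharedAction ρ U) : ℝ) : ℂ) •
    (1 : Matrix Unit Unit ℂ)
  a _ U := (Real.exp (β * WilsonSiteRP.sitePosAction ρ U) : ℂ)
  psd U := Matrix.PosSemidef.one.smul (Complex.zero_le_real.2 (by positivity))
  measK _ _ := by
    refine (Complex.measurable_ofReal.comp (measurable_const.mul
      ((WilsonSiteRP.measurable_sharedAction ρ hρ).const_mul β).exp)).mul measurable_const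
  bddK := by
    refine ⟨Real.exp (-β * (N * Fintype.card (Plaquette 4 L))) * Real.exp (|β| * (N * Fintype.card (Plaquette 4 L))),
      fun U i j => ?_⟩
    rw [Matrix.smul_apply, Matrix.one_apply_eq, smul_eq_mul, mul_one, Complex.norm_real, Real.norm_eq_abs,
      abs_of_pos (by positivity)]
    refine mul_le_mul_of_nonneg_left (Real.exp_le_exp.2 ?_) (Real.exp_pos _).le
    calc β * WilsonSiteRP.sharedAction ρ U ≤ |β * WilsonSiteRP.sharedAction ρ U| := le_abs_self _
      _ = |β| * |WilsonSiteRP.sharedAction ρ U| := abs_mul _ _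
      _ ≤ |β| * (N * Fintype.card (Plaquette 4 L)) :=
          mul_le_mul_of_nonneg_left (WilsonSiteRP.abs_sharedAction_le ρ hρ U) (abs_nonneg _)
  depK _ _ U V hUV := by simp only [WilsonSiteRP.dependsOn_sharedAction ρ hUV]
  measA _ := Complex.measurable_ofReal.comp ((WilsonSiteRP.measurable_sitePosAction ρ hρ).const_mul β).exp
  bddA := by
    refine ⟨Real.exp (|β| * (N * Fintype.card (Plaquette 4 L))), fun _ U => ?_⟩
    rw [Complex.norm_real, Real.norm_eq_abs, abs_of_pos (Real.exp_pos _)]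
    refine Real.exp_le_exp.2 ?_
    calc β * WilsonSiteRP.sitePosAction ρ U ≤ |β * WilsonSiteRP.sitePosAction ρ U| := le_abs_self _
      _ = |β| * |WilsonSiteRP.sitePosAction ρ U| := abs_mul _ _
      _ ≤ |β| * (N * Fintype.card (Plaquette 4 L)) :=
          mul_le_mul_of_nonneg_left (WilsonSiteRP.abs_sitePosAction_le ρ hρ U) (abs_nonneg _)
  depA _ U V hUV := by simp only [WilsonSiteRP.dependsOn_sitePosAction ρ hL hUV]
  eq U := by
    simp only [Finset.univ_unique, Finset.sum_singleton, Matrix.smul_apply, Matrix.one_apply_eq, smul_eq_mul,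
      mul_one, Complex.conj_ofReal]
    rw [WilsonSiteRP.wilsonAction_siteSplit ρ hL hρ U, show -β * (↑N * ↑(Fintype.card (Plaquette 4 L)) -
        (WilsonSiteRP.sitePosAction ρ U + WilsonSiteRP.sitePosAction ρ U.negReflect + WilsonSiteRP.sharedAction ρ U)) =
      -β * (↑N * ↑(Fintype.card (Plaquette 4 L))) + β * WilsonSiteRP.sharedAction ρ U +
        β * WilsonSiteRP.sitePosAction ρ U + β * WilsonSiteRP.sitePosAction ρ U.negReflect by ring,
      Real.exp_add, Real.exp_add, Real.exp_add]
    push_cast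
    ring

omit [Fact (1 < L)] [TopologicalSpace G] [IsTopologicalGroup G] [CompactSpace G] [BorelSpace G] in
/-- The Gram datum of the constant `1`. -/
def gramDataOne : GramData (fun _ : GaugeConfig 4 L G => (1 : ℂ)) where
  κ := Unit
  K _ := 1
  a _ _ := 1
  psd _ := Matrix.PosSemidef.one
  measK _ _ := measurable_const
  bddK := ⟨1, fun U i j => by simp⟩
  depK _ _ _ _ _ := rfl
  measA _ := measurable_const
  bddA := ⟨1, fun _ _ => by simp⟩
  depA _ _ _ _ := rfl
  eq U := by simp

omit [Fact (1 < L)] in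
/-- Continuous functions of the `SU(N)` gauge field are measurable (the link group is second
countable). -/
theorem measurable_of_continuous_cfg {f : GaugeConfig 4 L (Matrix.specialUnitaryGroup (Fin N) ℂ) → ℂ}
    (hf : Continuous f) : Measurable f := by
  haveI : SecondCountableTopology (Matrix (Fin N) (Fin N) ℂ) :=
    inferInstanceAs (SecondCountableTopology (Fin N → Fin N → ℂ))
  haveI : SecondCountableTopology (Matrix.specialUnitaryGroup (Fin N) ℂ) :=
    Topology.IsEmbedding.subtypeVal.secondCountableTopology
  exact hf.measurable

/-- **Gram datum of the antiperiodic Wilson fermion determinant** for `m ≥ -1` (helper files 5–7). -/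
def gramDataDet (hL : Even L) (h4 : 4 ≤ L) {m : ℝ} (hm : -1 ≤ m) :
    GramData (fun U : GaugeConfig 4 L (Matrix.specialUnitaryGroup (Fin N) ℂ) => (wilsonDiracAP U m).det) where
  κ := Finset (Fin (upCard L N)) × Finset (Fin (upCard L N))
  K U := gramKernel U m
  a I U := rho (upperBlock U m) I.1 I.2
  psd U := posSemidef_gramKernel hL h4 U hm
  measK I J := by
    simp only [gramKernel, Matrix.kroneckerMap_apply, Matrix.transpose_apply]
    exact measurable_of_continuous_cfg ((continuous_Gamma_comp (continuous_planeBlock m) _ _).mul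
      (continuous_Gamma_comp (continuous_planeBlock m) _ _))
  bddK := by
    have hK : ∀ I J : Finset (Fin (upCard L N)) × Finset (Fin (upCard L N)),
        Continuous fun U : GaugeConfig 4 L (Matrix.specialUnitaryGroup (Fin N) ℂ) => gramKernel U m I J := by
      intro I J
      simp only [gramKernel, Matrix.kroneckerMap_apply, Matrix.transpose_apply]
      exact (continuous_Gamma_comp (continuous_planeBlock m) _ _).mul (continuous_Gamma_comp (continuous_planeBlock m) _ _)
    have hc : Continuous fun U : GaugeConfig 4 L (Matrix.specialUnitaryGroup (Fin N) ℂ) =>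
        ∑ I : Finset (Fin (upCard L N)) × Finset (Fin (upCard L N)), ∑ J : Finset (Fin (upCard L N)) ×
          Finset (Fin (upCard L N)), ‖gramKernel U m I J‖ :=
      continuous_finsetSum _ fun I _ => continuous_finsetSum _ fun J _ => (hK I J).norm
    obtain ⟨C, hC⟩ := exists_bound_of_continuous hc
    refine ⟨C, fun U I J => le_trans ?_ ((le_abs_self _).trans ((Real.norm_eq_abs _).symm.trans_le (hC U)))⟩
    exact (Finset.single_le_sum (f := fun J => ‖gramKernel U m I J‖) (fun _ _ => norm_nonneg _)
      (Finset.mem_univ J)).trans (Finset.single_le_sum (f := fun I => ∑ J, ‖gramKernel U m I J‖)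
        (fun _ _ => Finset.sum_nonneg fun _ _ => norm_nonneg _) (Finset.mem_univ I))
  depK I J U V hUV := by
    simp only [gramKernel, Matrix.kroneckerMap_apply, Matrix.transpose_apply, dependsOn_planeBlock hL h4 m hUV]
  measA I := measurable_of_continuous_cfg (continuous_rho_comp (continuous_upperBlock m) _ _)
  bddA := by
    have hc : Continuous fun U : GaugeConfig 4 L (Matrix.specialUnitaryGroup (Fin N) ℂ) =>
        ∑ I : Finset (Fin (upCard L N)) × Finset (Fin (upCard L N)), ‖rho (upperBlock U m) I.1 I.2‖ :=
      continuous_finsetSum _ fun I _ => (continuous_rho_comp (continuous_upperBlock m) _ _).norm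
    obtain ⟨C, hC⟩ := exists_bound_of_continuous hc
    refine ⟨C, fun I U => le_trans ?_ ((le_abs_self _).trans ((Real.norm_eq_abs _).symm.trans_le (hC U)))⟩
    exact Finset.single_le_sum (f := fun I : Finset (Fin (upCard L N)) × Finset (Fin (upCard L N)) =>
      ‖rho (upperBlock U m) I.1 I.2‖) (fun _ _ => norm_nonneg _) (Finset.mem_univ I)
  depA I U V hUV := by simp only [dependsOn_upperBlock hL h4 m hUV]
  eq U := det_wilsonDiracAP_eq_gram hL h4 U m

end Specific

/-! ## Positivity of the integral of a function with a Gram datum -/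

section Positivity

variable {L : ℕ} [NeZero L] [Fact (1 < L)] {G : Type*} [Group G] [TopologicalSpace G]
  [IsTopologicalGroup G] [CompactSpace G] [MeasurableSpace G] [BorelSpace G]

/-- A quadratic form of a positive semidefinite matrix, written out, is a non-negative real. -/
theorem sum_sum_mul_mul_conj_nonneg {κ : Type*} [Fintype κ] {K : Matrix κ κ ℂ} (hK : K.PosSemidef) (x : κ → ℂ) :
    0 ≤ ∑ i, ∑ j, K i j * x i * conj (x j) := by
  have h := (Matrix.posSemidef_iff_dotProduct_mulVec.1 hK.transpose).2 x
  convert h using 1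
  simp only [dotProduct, mulVec, Matrix.transpose_apply, Pi.star_apply, Finset.mul_sum, RCLike.star_def]
  rw [Finset.sum_comm]
  exact Finset.sum_congr rfl fun j _ => Finset.sum_congr rfl fun i _ => by ring

/-- **A function with a Gram datum has a non-negative integral.** -/
theorem GramData.integral_nonneg (hL : Even L) {k : GaugeConfig 4 L G → ℂ} (d : GramData k) :
    0 ≤ ∫ U, k U ∂(LatticeRP.piMeasure (ι := Edge 4 L) (haarProbability G)) := by
  classical
  set μ : Measure (GaugeConfig 4 L G) := LatticeRP.piMeasure (haarProbability G) with hμ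
  set P : Finset (Edge 4 L) := WilsonSiteRP.sitePosEdges with hP
  set M : Finset (Edge 4 L) := WilsonSiteRP.sharedEdges with hM
  obtain ⟨CK, hCK⟩ := d.bddK
  obtain ⟨CA, hCA⟩ := d.bddA
  have hconj : Measurable (starRingEnd ℂ : ℂ → ℂ) := Complex.continuous_conj.measurable
  have hΘm : Measurable (GaugeConfig.negReflect : GaugeConfig 4 L G → GaugeConfig 4 L G) :=
    WilsonSiteRP.measurable_negReflect
  -- the averaged features
  set χ : d.κ → GaugeConfig 4 L G → ℂ := fun i V => ∫ W, d.a i (LatticeRP.splice P (V, W)) ∂μ with hχ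
  have hχm : ∀ i, Measurable (χ i) := fun i =>
    LatticeRP.measurable_integral_parametric ((d.measA i).comp (LatticeRP.measurable_splice P))
  have hχb : ∀ i V, ‖χ i V‖ ≤ CA := fun i V => LatticeRP.norm_integral_le_of_norm_le_prob fun W => hCA i _
  have hPM : ∀ {f : GaugeConfig 4 L G → ℂ}, DependsOn f ((M : Finset (Edge 4 L)) : Set (Edge 4 L)) →
      DependsOn f ((P ∪ M : Finset (Edge 4 L)) : Set (Edge 4 L)) := fun hf U V hUV =>
    hf fun e he => hUV e (by rw [Finset.coe_union]; exact Or.inr he)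
  -- termwise: the polarised shared-block identity
  have hterm : ∀ i j, ∫ U, d.K U i j * d.a i U * conj (d.a j (GaugeConfig.negReflect U)) ∂μ =
      ∫ V, d.K V i j * (χ i V * conj (χ j V)) ∂μ := by
    intro i j
    have key := integral_mul_conj_comp_eq_integral_avg (haarProbability G) M P GaugeConfig.negReflect
      WilsonSiteRP.measurePreserving_negReflect
      (fun U e he => WilsonSiteRP.negReflect_apply_of_mem_sharedEdges hL U e he)
      (fun e he => WilsonSiteRP.dependsOn_negReflect_apply hL e (Finset.mem_union_left _ he))
      WilsonSiteRP.disjoint_sharedEdges_sitePosEdges (Φ := fun U => d.K U i j * d.a i U) (Ψ := d.a j)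
      ((d.measK i j).mul (d.measA i)) (d.measA j)
      (K := max (CK * CA) CA) (fun U => by
        rw [norm_mul]
        exact (mul_le_mul (hCK U i j) (hCA i U) (norm_nonneg _) ((norm_nonneg _).trans (hCK U i j))).trans
          (le_max_left _ _))
      (fun U => (hCA j U).trans (le_max_right _ _))
      (fun U V hUV => by
        have h1 : d.K U i j = d.K V i j := hPM (d.depK i j) hUV
        simp only [h1, d.depA i hUV]) (d.depA j)
    rw [key]
    refine integral_congr_ae (ae_of_all _ fun V => ?_)
    have hK : ∀ W, d.K (LatticeRP.splice P (V, W)) i j = d.K V i j := fun W =>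
      LatticeRP.apply_splice_of_dependsOn_of_disjoint (d.depK i j) WilsonSiteRP.disjoint_sharedEdges_sitePosEdges V W
    simp_rw [hK]
    rw [integral_const_mul, mul_assoc]
  -- integrability bookkeeping
  have hint : ∀ i j, Integrable (fun U => d.K U i j * d.a i U * conj (d.a j (GaugeConfig.negReflect U))) μ :=
    fun i j => LatticeRP.integrable_of_norm_le (((d.measK i j).mul (d.measA i)).mul
      (hconj.comp ((d.measA j).comp hΘm))) (K := CK * CA * CA) fun U => by
        rw [norm_mul, norm_mul, Complex.norm_conj]
        exact mul_le_mul (mul_le_mul (hCK U i j) (hCA i U) (norm_nonneg _) ((norm_nonneg _).trans (hCK U i j)))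
          (hCA j _) (norm_nonneg _) (mul_nonneg ((norm_nonneg _).trans (hCK U i j)) ((norm_nonneg _).trans (hCA i U)))
  have hint' : ∀ i j, Integrable (fun V => d.K V i j * (χ i V * conj (χ j V))) μ := fun i j =>
    LatticeRP.integrable_of_norm_le ((d.measK i j).mul ((hχm i).mul (hconj.comp (hχm j)))) (K := CK * (CA * CA))
      fun V => by
        rw [norm_mul, norm_mul, Complex.norm_conj]
        exact mul_le_mul (hCK V i j) (mul_le_mul (hχb i V) (hχb j V) (norm_nonneg _) ((norm_nonneg _).trans
          (hχb i V))) (mul_nonneg (norm_nonneg _) (norm_nonneg _)) ((norm_nonneg _).trans (hCK V i j))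
  -- assemble
  have hout : ∫ U, k U ∂μ = ∑ i, ∑ j, ∫ U, d.K U i j * d.a i U * conj (d.a j (GaugeConfig.negReflect U)) ∂μ := by
    simp_rw [d.eq]
    rw [integral_finsetSum _ fun i _ => integrable_finsetSum _ fun j _ => hint i j]
    exact Finset.sum_congr rfl fun i _ => integral_finsetSum _ fun j _ => hint i j
  have hin : ∑ i, ∑ j, ∫ V, d.K V i j * (χ i V * conj (χ j V)) ∂μ =
      ∫ V, ∑ i, ∑ j, d.K V i j * (χ i V * conj (χ j V)) ∂μ := by
    rw [integral_finsetSum _ fun i _ => integrable_finsetSum _ fun j _ => hint' i j]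
    exact Finset.sum_congr rfl fun i _ => (integral_finsetSum _ fun j _ => hint' i j).symm
  rw [hout]
  simp_rw [hterm]
  rw [hin]
  have hnn : ∀ V, 0 ≤ ∑ i, ∑ j, d.K V i j * (χ i V * conj (χ j V)) := fun V => by
    simp_rw [← mul_assoc]
    exact sum_sum_mul_mul_conj_nonneg (d.psd V) fun i => χ i V
  have hre : (fun V => ∑ i, ∑ j, d.K V i j * (χ i V * conj (χ j V))) =
      fun V => (((∑ i, ∑ j, d.K V i j * (χ i V * conj (χ j V))).re : ℝ) : ℂ) := by
    funext V
    obtain ⟨h1, h2⟩ := Complex.nonneg_iff.1 (hnn V)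
    exact Complex.ext (by simp) (by simp [← h2])
  rw [hre, integral_complex_ofReal]
  exact Complex.zero_le_real.2 (MeasureTheory.integral_nonneg fun V => (Complex.nonneg_iff.1 (hnn V)).1)

end Positivity

/-! ## The stub -/

/-- **Stub `marginalRP`** (= route support item `MarginalSiteRP`, stmt-QuantumFields-9740, in the
tree's `negReflect` vocabulary). For the site reflection `Θ'` in the lattice hyperplanes `t = 0`,
`t = L/2` of the even four-torus and every bounded measurable half-observable `F` (a function of the
links of the closed half `0 ≤ t ≤ L/2`), the SIGNED det-weighted Wilson functional satisfies
`∫ conj F(Θ'U) · F(U) · ∏_f det D_AP[U, m_f] · e^{-β S_W(U)} ∏dU ≥ 0` (a non-negative real) whenever all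
`m_f > -1` (`κ_f < 1/6`): the restriction of Lüscher / Osterwalder–Seiler joint site-reflection
positivity to Grassmann-free observables, equivalently the chirality-split Schur–Gram factorisation
`det D_AP[U] = det C₁ det C₂ · G(U₊) · conj G((Θ'U)₊) · det(1 + W((Θ'U)₊)ᴴ W(U₊))` fed into the
tree's shared-block mechanism `LatticeRP.integral_mul_conj_mul_exp_nonneg_of_shared`. -/
theorem stub_marginalRP (Nf L : ℕ) [NeZero L] [Fact (1 < L)] (hL : Even L) (h4 : 4 ≤ L) (β : ℝ)
    (m : Fin Nf → ℝ) (hm : ∀ f, -1 < m f) (F : GaugeConfig 4 L (Matrix.specialUnitaryGroup (Fin 3) ℂ) → ℂ)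
    (hF : WilsonSiteRP.IsHalfObs F) :
    0 ≤ ∫ U, conj (F (GaugeConfig.negReflect U)) * F U *
        ((∏ f, (wilsonDiracAP U (m f)).det) * (Real.exp (-β * wilsonAction (fundamentalRep (Fin 3)) U) : ℂ))
      ∂(Measure.pi fun _ : Edge 4 L => haarProbability (Matrix.specialUnitaryGroup (Fin 3) ℂ)) := by
  have d : GramData (fun U : GaugeConfig 4 L (Matrix.specialUnitaryGroup (Fin 3) ℂ) =>
      conj (F (GaugeConfig.negReflect U)) * F U *
        ((∏ f, (wilsonDiracAP U (m f)).det) * (Real.exp (-β * wilsonAction (fundamentalRep (Fin 3)) U) : ℂ))) :=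
    (((gramDataHalfObs hF).mul (gramDataProd (fun f U => (wilsonDiracAP U (m f)).det)
      (fun f => gramDataDet hL h4 (hm f).le) gramDataOne)).mul
      (gramDataGauge hL (fundamentalRep (Fin 3)) (continuous_fundamentalRep (Fin 3)) β)).congr fun U => by ring
  exact d.integral_nonneg hL

end Summit.QuantumFields.QCD.Theorems.UnquenchedChessboardBoundLine

end
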